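import Summits.BirchSwinnertonDyer.BirchSwinnertonDyer.Theses.UniversalToricDescent
import Summits.BirchSwinnertonDyer.BirchSwinnertonDyer.Theorems.UniversalToricDescentKernelRationalRoadOfPrint
import Summits.BirchSwinnertonDyer.BirchSwinnertonDyer.Theorems.UniversalToricDescentKernelRationalRoadOddMuOfR2
import HarnessLib

/-!
# Route `UniversalToricDescent` — kernel_rat⁺ `ToricKernelAtThreeApZeroOddRationalTwinMuOfPrint` (stmt-BirchSwinnertonDyer-24256) BY NAME

RK-6 v3 (pen bsd-wall-pss3x g8; director (361)/(362); LEAD bsd-wall-utd-p1 g19 finding 07:55Z): the RATIONAL road's kernel —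
kernel⁵ 22543's text with `DefectTransportModThreePT → AdditiveSplitIMCInclusionAtThree →` replaced by
`SigmaCongruenceAtThree → RationalSplitIMCInclusionAtThree →` and the twin's ALGEBRAIC `μ = 0` `TwinAlgMuZeroAtThree →` (24254)
inserted after `TwinMuZeroAtThree →` (the `μ`-source the rational road needs: integral wall = rational wall + `μ(X_E) = 0`, and
`μ(X_E) = 0 ⟺` twin torsion `∧ μ_alg(X_{E′}) = 0` by GV Prop. 2.8, tree `torsionMuTransportModThree`). Proof = the landed
`…KernelRationalRoad.bsdp_three_of_sigma_of_ratwall_of_degreePackage_of_print` (p708172 §1–§2 + part 2 §3–§4: kernel⁵'s proof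
p640116 VERBATIM with the per-instance IMC equality at `E` taken from A + rational wall + twin algebraic `μ = 0` instead of the wall),
applied to the twelve hypotheses in order (`hTμ` moved to the end).

HONEST FRAMING: an IMPLICATION between route items; closes the support item 24256 only — A 27120, the rational wall 24207,
`TwinAlgMuZeroAtThree` 24254 (print for good-ordinary twins, research for multiplicative / supersingular twins), ♭B′° / ♭C₀°, the leaves …
stay open/research. BSD is proved for no curve by this file. References: [GreenbergVatsal2000] Thm. (1.4), Prop. (2.8);
[JetchevSkinnerWan2017] §7.4.1.

RESTATE-ROBUST PROOF (LEAD bsd-wall-utd-p1 g20, director (367)/(368)(4)(iv), pen G9-TOUCH-24254-R2): the statement names the route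
decl `TwinAlgMuZeroAtThree` (24254), which the pen restates 1:1 to the consumer-minimal text R2 (odd `d_K`, twin buckets
`(Mult ∧ très ramifié) ∨ (GoodSS ∧ a₃ = 0)`; `HOME/bsd-wall-pss3x/g8/rk6v3/twinalg_min_1l.txt`) or its fallback R1 (odd `d_K`, all
non-additive twins). The proof below is a `first` over the three texts: the LIVE text (p708518's package theorem), R2
(`…KernelRationalRoadOdd.kernelRat_of_r2Text`, utd-p1-w2 g6) and R1 (`…kernelRat_of_r1Text`); whichever text the route file carries
when this file is (re-)elaborated, exactly one alternative typechecks, so the restate opens no red window in the Theorems tree and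
24256 stays closed by the same declaration. `linter.unreachableTactic` is switched off for this one declaration because the two idle
alternatives are, by design, never executed.
-/

set_option linter.dupNamespace false
set_option autoImplicit false

namespace Summit.BirchSwinnertonDyer.BirchSwinnertonDyer.Theorems.UniversalToricDescentToricKernelAtThreeApZeroOddRationalTwinMuOfPrint

open Summit.BirchSwinnertonDyer.BirchSwinnertonDyer.Theses.UniversalToricDescent
  Summit.BirchSwinnertonDyer.BirchSwinnertonDyer.Theorems.UniversalToricDescentKernelRationalRoad

set_option linter.unreachableTactic false in
set_option linter.unusedTactic false in
/-- **kernel_rat⁺ `ToricKernelAtThreeApZeroOddRationalTwinMuOfPrint` (item stmt-BirchSwinnertonDyer-24256) BY NAME**: the printed inputs,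
A = `SigmaCongruenceAtThree`, the rational wall, analytic and algebraic twin `μ = 0`, the degree package, the supplies and leaves imply
`BSDp W 3` on every wild `O6` curve of analytic rank one with `ρ̄₃` onto having a `3`-congruent non-additive onto twin. CONDITIONAL on
every displayed antecedent; closes the support item only. [cite: GreenbergVatsal2000, Thm. (1.4), Prop. (2.8)] [cite: JetchevSkinnerWan2017, §7.4.1] -/
theorem toricKernelAtThreeApZeroOddRationalTwinMuOfPrint_proof : ToricKernelAtThreeApZeroOddRationalTwinMuOfPrint := by
  intro hF hA hR hM hTμ h3 hsupply hres hW hS hL hZ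
  first
    -- (i) LIVE text of `TwinAlgMuZeroAtThree` (¬ Addv twins, any `d_K`): LEAD g19's package theorem (p708518)
    | exact bsdp_three_of_sigma_of_ratwall_of_degreePackage_of_print hF hA hR hM h3 hsupply hres hW hS hL hZ hTμ
    -- (ii) after `--restate TwinAlgMuZeroAtThree := R2` (odd `d_K`, kernel twin buckets): utd-p1-w2 g6's `kernelRat_of_r2Text`
    | exact Summit.BirchSwinnertonDyer.BirchSwinnertonDyer.Theorems.UniversalToricDescentKernelRationalRoadOdd.kernelRat_of_r2Text
        hF hA hR hM hTμ h3 hsupply hres hW hS hL hZ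
    -- (iii) after `--restate TwinAlgMuZeroAtThree := R1` (odd `d_K`, all non-additive twins): `kernelRat_of_r1Text`
    | exact Summit.BirchSwinnertonDyer.BirchSwinnertonDyer.Theorems.UniversalToricDescentKernelRationalRoadOdd.kernelRat_of_r1Text
        hF hA hR hM hTμ h3 hsupply hres hW hS hL hZ

end Summit.BirchSwinnertonDyer.BirchSwinnertonDyer.Theorems.UniversalToricDescentToricKernelAtThreeApZeroOddRationalTwinMuOfPrint
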